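import Summits.ResolutionOfSingularities.ResolutionOfSingularities.Theorems.TightDefectStrongWalks
import Literature.AlgebraicGeometry.Resolution.PointBlowupMohWitnessPrimePower
import Literature.AlgebraicGeometry.Resolution.PointBlowupMohBoundPrimePower
import Literature.AlgebraicGeometry.Resolution.OrdZeroBasics
import HarnessLib

/-!
# ItineraryCutClasses — the decomp-res node «ItineraryCut» (lens-3 g10, CRITIC-LEDGER row 68 CLEARED AS DICHOTOMY
  NODE), route-independent part

Source: HOME/decomp-res-lens-3/g10/ItineraryCut.lean (sha256 6a8a225d7388ac1f…, seat planner-decomp-res-lens-3-g10-0),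
§§1–5 verbatim up to (i) the removal of `ne_zero_of_isolatedTop` (already landed in `Theorems.TightDefectStrongWalks`,
used BY NAME) and (ii) the route-dependent `closes` (the host route MaxContactCut reaches the root by its own
`closes`; by-name kernels in `Theorems.MaxContactCutItineraryCut`).

BLOCKER cut here (tree decl, verbatim): `Theorems.TightDefectClasses.DefectWalksTerminateDeep` (MaxContactCut aside
31770 `DefectWalksDeep`) — «no infinite FORCED walk of Hauser's point-blow-up model at exponent `q = pᵉ`, `e ≥ 2`, in
three variables over a perfect field keeps positive shade at every stage» (the located residual of lens 3 g9, critic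
row 61; the E-core of MaxContactCut 30253/30256 ∩ pure polynomial heads, modulo `TowerDictionary`).

## The ONE translation (the single allowed EQUIV) — the SHADE ITINERARY

A forced deep walk `W` is read through its itinerary `t ↦ shade (W.st t) ∈ ℕ∞` — an infinite word over the three edge
letters {drop, stall, jump}.  Because `ℕ∞` is well-ordered, an infinite itinerary is of exactly one of two kinds
(kernel `recurrentJumps_or_eventuallyStalls`, PROVED, pure order theory): PLATEAU — from some time on the shade is
constant; RECURRENT-JUMP — the shade increases (a kangaroo / antelope step) at infinitely many times.  Hence the EXACT
split (PROVED, `defectDeep_iff`): `DefectWalksTerminateDeep ⟺ NoPlateauWalksDeep ∧ NoRecurrentJumpWalksDeep`.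

## Split beneath the translation (all PROVED, by pulling the tree's Moh / Hauser–Perlega theorems back along
`ForcedWalk`): `shade_succ_le` (Moh's bound: a jump is at most `p^{e-1}`); `resonant_of_jump` (W3: at a jump time
EVERY
non-exceptional variable divides every initial monomial to a `q`-th power); `not_jump_of_boundaryFree` (a walk NEVER
jumps from a boundary-free state, so `NoRecurrentJumpWalksDeep ⟺ NoRecurrentBoundaryJumpWalksDeep`, PROVED);
`exists_drop_before_rise_of_witness` (W1) / `exists_drop_before_rejump_of_dvd_landing` (W2).

## Pieces and tags (critic row 68): `NoPlateauWalksDeep` — UNDECIDED · WEAKER (`noPlateau_of_deep`) · IDEA-NEEDED ·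
INSTRUMENTABLE (T-plateau: Hasse–Milnor colength `μ_q` on stall steps; 499/499 sampled non-pick-up stalls drop, but
`μ_q` is NOT a Lyapunov function); `NoRecurrentJumpWalksDeep` — UNDECIDED · WEAKER (`noRecurrentJump_of_deep`) ·
IDEA-NEEDED · ATTACKABLE (jump calculus: boundary-resonant, Moh-bounded, drop-before-re-rise) · INSTRUMENTABLE
T-jump-e2; `NoRecurrentBoundaryJumpWalksDeep` — EXACT reformulation of the jump half (decided complement «no jump at
r = 0», kernel-proved, no piece credit).  Critic: DISTRIBUTED ✗ strictly (bisection, both halves open) — accepted as a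
dichotomy node; MAP +1.  BARRIER notes: `KangarooShadeIncrease` / `ResidualOrderUnbounded*` are `e = 1` specimens and
sit in the RECURRENT-JUMP half by construction.

WHY NOVEL (by construction): the other lenses carve the blocker by a class of the SINGULARITY; this node carves it by
a class of the RESOLUTION PROCESS — the tail type of the shade itinerary — with a PROVED dynamical dichotomy and
PROVED
structural constraints (boundary resonance) on one half.  WHY EACH PIECE IS WEAKER: each half quantifies over a
sub-family of the walks of the blocker; neither sub-family is known to be empty and neither half implies the other.

(Sources: Hauser2010 §§F–G; HauserPerlega2019; Moh1987; CossartPiltant2019 p.4; Benito–Villamayor 2013 §7.)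
-/

open MvPolynomial
open Literature.AlgebraicGeometry.Resolution
open Literature.AlgebraicGeometry.Resolution.Hauser2010
open Literature.AlgebraicGeometry.Resolution.PointBlowup
open Summit.ResolutionOfSingularities.ResolutionOfSingularities.Theorems.TightDefectClasses
open Summit.ResolutionOfSingularities.ResolutionOfSingularities.Theorems.TightDefectStrongWalks

namespace Summit.ResolutionOfSingularities.ResolutionOfSingularities.Theorems.ItineraryCutClasses

/-! ## §1 Itineraries — pure order theory (the kernel of the translation) -/

section Itinerary

variable {α : Type*} [LinearOrder α]

/-- The itinerary `f` JUMPS at time `t`.  DEFINITION (support). -/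
def JumpAt (f : ℕ → α) (t : ℕ) : Prop := f t < f (t + 1)

/-- The itinerary jumps at infinitely many times.  DEFINITION (support). -/
def RecurrentJumps (f : ℕ → α) : Prop := ∀ N : ℕ, ∃ t, N ≤ t ∧ JumpAt f t

/-- The itinerary is eventually constant (a PLATEAU: only stalls from some time on).  DEFINITION (support). -/
def EventuallyStalls (f : ℕ → α) : Prop := ∃ N : ℕ, ∀ t, N ≤ t → f (t + 1) = f t

/-- **Kernel (PROVED).** In a well-ordered value set, an itinerary with only finitely many jumps is eventually
constant: past the last jump it is non-increasing, and a non-increasing sequence in a well-order is eventually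
constant. [folklore] -/
theorem eventuallyStalls_of_not_recurrentJumps [WellFoundedLT α] (f : ℕ → α) (h : ¬ RecurrentJumps f) :
    EventuallyStalls f := by
  classical
  unfold RecurrentJumps JumpAt at h
  push Not at h
  obtain ⟨N, hN⟩ := h
  have hstep : ∀ k, f (N + k + 1) ≤ f (N + k) := fun k => hN (N + k) (Nat.le_add_right N k)
  have hanti : ∀ k l, f (N + k + l) ≤ f (N + k) := by
    intro k l
    induction l with
    | zero => exact le_rfl
    | succ l ih =>
      have h1 := hstep (k + l)
      rw [show N + (k + l) + 1 = N + k + (l + 1) by omega, show N + (k + l) = N + k + l by omega] at h1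
      exact h1.trans ih
  obtain ⟨m₀, hm₀⟩ : ∃ m₀, ∀ k, ¬ f (N + k) < f (N + m₀) := by
    obtain ⟨a, ⟨m₀, rfl⟩, hmin⟩ :=
      WellFounded.has_min wellFounded_lt (Set.range fun k => f (N + k)) ⟨f (N + 0), 0, rfl⟩
    exact ⟨m₀, fun k => hmin _ ⟨k, rfl⟩⟩
  refine ⟨N + m₀, fun t ht => ?_⟩
  obtain ⟨k, rfl⟩ := Nat.exists_eq_add_of_le ht
  have e1 : f (N + m₀ + (k + 1)) = f (N + m₀) := le_antisymm (hanti m₀ (k + 1)) (not_lt.mp (by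
    have := hm₀ (m₀ + (k + 1)); rwa [show N + (m₀ + (k + 1)) = N + m₀ + (k + 1) by omega] at this))
  have e2 : f (N + m₀ + k) = f (N + m₀) := le_antisymm (hanti m₀ k) (not_lt.mp (by
    have := hm₀ (m₀ + k); rwa [show N + (m₀ + k) = N + m₀ + k by omega] at this))
  rw [show N + m₀ + k + 1 = N + m₀ + (k + 1) by omega, e1, e2]

/-- **The dichotomy of infinite itineraries (PROVED).** [folklore] -/
theorem recurrentJumps_or_eventuallyStalls [WellFoundedLT α] (f : ℕ → α) :
    RecurrentJumps f ∨ EventuallyStalls f := by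
  by_cases h : RecurrentJumps f
  · exact Or.inl h
  · exact Or.inr (eventuallyStalls_of_not_recurrentJumps f h)

/-- The two tail types exclude each other (PROVED). [folklore] -/
theorem not_recurrentJumps_of_eventuallyStalls (f : ℕ → α) (h : EventuallyStalls f) : ¬ RecurrentJumps f := by
  rintro hR
  obtain ⟨N, hN⟩ := h
  obtain ⟨t, ht, hj⟩ := hR N
  exact absurd (hN t ht) (ne_of_gt hj)

end Itinerary

/-! ## §2 Bookkeeping along a forced walk (order `≥ q`, `F ≠ 0`, `u^r ∣ F`, cleaned) -/

section Walk

variable {K : Type} [Field K] [DecidableEq K]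

omit [DecidableEq K] in
/-- Deleting the `q`-th powers is idempotent. [folklore] -/
theorem deletePthPowers_idem (q : ℕ) (P : MvPolynomial (Fin 3) K) :
    deletePthPowers q (deletePthPowers q P) = deletePthPowers q P := by
  classical
  ext d
  rw [coeff_deletePthPowers, coeff_deletePthPowers]
  split_ifs <;> rfl

variable {q : ℕ} {s₀ : State (Fin 3) K}

/-- Along a forced walk from a root the order stays `≥ q`. [folklore] -/
theorem walk_ord (hroot : IsRoot q s₀) (W : ForcedWalk q s₀) (n : ℕ) : ((q : ℕ) : ℕ∞) ≤ ordZero (W.st n).F := by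
  induction n with
  | zero => rw [W.st_zero]; exact hroot.2.2
  | succ n ih =>
    rw [W.st_succ]
    exact le_ordZero_step_of_isEquimultiplePoint _ _ _ _ (W.equimult n)

/-- … the order is a natural number `o ≥ q` (the residual polynomial is non-zero by isolation). [folklore] -/
theorem walk_nat (hroot : IsRoot q s₀) (W : ForcedWalk q s₀) (n : ℕ) :
    ∃ o : ℕ, ordZero (W.st n).F = o ∧ q ≤ o := by
  obtain ⟨o, ho⟩ := exists_ordZero_eq_natCast (ne_zero_of_isolatedTop (W.isolated n))
  refine ⟨o, ho, ?_⟩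
  have := walk_ord hroot W n
  rw [ho] at this
  exact_mod_cast this

/-- … `u^r ∣ F` (as the support bound `r ≤ d`). [folklore] -/
theorem walk_r (hroot : IsRoot q s₀) (W : ForcedWalk q s₀) (n : ℕ) : ∀ d ∈ (W.st n).F.support, (W.st n).r ≤ d := by
  induction n with
  | zero =>
    intro d _
    rw [W.st_zero, hroot.1]
    exact Finsupp.le_def.mpr fun i => by simp
  | succ n ih =>
    obtain ⟨o, ho, -⟩ := walk_nat hroot W n
    rw [W.st_succ]
    exact newMult_le_of_mem_support_step _ _ _ (W.onExc n) _ ho ih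

omit [DecidableEq K] in
/-- … and every state is cleaned. [folklore] -/
theorem walk_clean [DecidableEq K] (hroot : IsRoot q s₀) (W : ForcedWalk q s₀) (n : ℕ) :
    deletePthPowers q (W.st n).F = (W.st n).F := by
  cases n with
  | zero => rw [W.st_zero]; exact hroot.2.1
  | succ n => rw [W.st_succ]; exact deletePthPowers_idem q _

end Walk

/-! ## §3 The jump calculus along forced walks (tree Moh / Hauser–Perlega theorems pulled back; all PROVED) -/

section Jumps

variable {p e : ℕ} {K : Type} [Field K] [CharP K p] [DecidableEq K] {s₀ : State (Fin 3) K}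

/-- A state is RESONANT: every NON-exceptional variable `u_i` (`r_i = 0`) occurs in every initial monomial with a
`q`-divisible exponent (Hauser's necessary condition for a kangaroo point, W3 form).  DEFINITION (support).
(Sources: Hauser2010 §F «kangaroo points»; HauserPerlega2019.) -/
def Resonant (q : ℕ) (s : State (Fin 3) K) : Prop :=
  ∀ i, s.r i = 0 → ∀ d ∈ s.F.support, ((d.degree : ℕ) : ℕ∞) = ordZero s.F → q ∣ d i

/-- **Moh's bound along a forced walk (PROVED from tree `mohBound`)**: a jump raises the shade by at most `p^{e-1}`.
(Sources: Moh1987, Stability Theorem.) [folklore] -/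
theorem shade_succ_le (hp : p.Prime) (he : 1 ≤ e) (hroot : IsRoot (p ^ e) s₀) (W : ForcedWalk (p ^ e) s₀) (n : ℕ) :
    (W.st (n + 1)).shade ≤ (W.st n).shade + ((p ^ (e - 1) : ℕ) : ℕ∞) := by
  haveI : Fact p.Prime := ⟨hp⟩
  rw [W.st_succ]
  exact mohBound p he (W.j n) (W.b n) (W.onExc n) (W.st n) (walk_clean hroot W n) (walk_ord hroot W n)
    (walk_r hroot W n)

/-- **W3 along a forced walk (PROVED from tree `pow_dvd_apply_of_shadeIncreases_of_nonexceptional`)**: a state from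
which the walk jumps is resonant. [folklore]
(Sources: Hauser2010 §F.) -/
theorem resonant_of_jump (hp : p.Prime) (hroot : IsRoot (p ^ e) s₀) (W : ForcedWalk (p ^ e) s₀) (n : ℕ)
    (hinc : (W.st n).shade < (W.st (n + 1)).shade) : Resonant (p ^ e) (W.st n) := by
  haveI : Fact p.Prime := ⟨hp⟩
  intro i hri d hd hdeg
  obtain ⟨o, ho, hqo⟩ := walk_nat hroot W n
  have hddeg : d.degree = o := by
    rw [ho] at hdeg
    exact_mod_cast hdeg
  have hinc' : ShadeIncreases (p ^ e) (W.j n) (W.b n) (W.st n) := by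
    unfold ShadeIncreases
    rw [← W.st_succ]
    exact hinc
  exact pow_dvd_apply_of_shadeIncreases_of_nonexceptional p (W.j n) (W.b n) (W.onExc n) (W.st n) ho hqo
    (walk_r hroot W n) hinc' hri hd hddeg

/-- **No jump from a boundary-free state (PROVED)**: if `r = 0` at time `n` (e.g. at the root, or right after the
walk has left every old component at a point of order exactly `q`), the walk does not jump at `n` — all three
variables would be resonant, so an initial monomial would be a `q`-th power, which the cleaning has deleted.
[folklore]
(Sources: Hauser2010 §F.) -/
theorem not_jump_of_boundaryFree (hp : p.Prime) (hroot : IsRoot (p ^ e) s₀) (W : ForcedWalk (p ^ e) s₀) (n : ℕ)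
    (hr0 : (W.st n).r = 0) : ¬ (W.st n).shade < (W.st (n + 1)).shade := by
  classical
  intro hinc
  obtain ⟨o, ho, -⟩ := walk_nat hroot W n
  obtain ⟨⟨d, hd, hdeg⟩, -⟩ := (ordZero_eq_nat_iff _ _).mp ho
  have hdmem : d ∈ (W.st n).F.support := MvPolynomial.mem_support_iff.mpr hd
  have hres := resonant_of_jump hp hroot W n hinc
  have hall : IsPthPowerExponent (p ^ e) d := fun i _ =>
    hres i (by rw [hr0]; rfl) d hdmem (by rw [ho, hdeg])
  have hcoeff : coeff d (deletePthPowers (p ^ e) (W.st n).F) = 0 := by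
    rw [coeff_deletePthPowers, if_pos hall]
  rw [walk_clean hroot W n] at hcoeff
  exact hd hcoeff

/-- In particular the FIRST step of a forced walk from a root is never a jump (PROVED). [folklore]
(Sources: Hauser2010 §F.) -/
theorem not_jump_zero (hp : p.Prime) (hroot : IsRoot (p ^ e) s₀) (W : ForcedWalk (p ^ e) s₀) :
    ¬ (W.st 0).shade < (W.st 1).shade :=
  not_jump_of_boundaryFree hp hroot W 0 (by rw [W.st_zero]; exact hroot.1)

/-- A state carries a `q`-WITNESS: a non-exceptional variable with a non-`q`-divisible exponent in some initial
monomial (the negation of resonance, located).  DEFINITION (support). (Sources: HauserPerlega2019; Moh1987.) -/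
def HasWitness (q : ℕ) (s : State (Fin 3) K) : Prop :=
  ∃ (i₀ : Fin 3) (o₀ : ℕ) (d₀ : Fin 3 →₀ ℕ), ordZero s.F = o₀ ∧ d₀ ∈ s.F.support ∧ d₀.degree = o₀ ∧
    ¬ q ∣ d₀ i₀ ∧ s.r i₀ = 0

/-- **W1 along a forced walk (PROVED from tree `exists_drop_of_shade_lt_of_pow_witness`)**: from a witnessed state,
the shade cannot rise above its current level without a strict drop in between. (Sources: Moh1987, Stability
Theorem.) [folklore] -/
theorem exists_drop_before_rise_of_witness (hp : p.Prime) (hroot : IsRoot (p ^ e) s₀) (W : ForcedWalk (p ^ e) s₀)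
    (n : ℕ) (hw : HasWitness (p ^ e) (W.st n)) (m : ℕ) (hm : (W.st n).shade < (W.st (n + m)).shade) :
    ∃ l < m, (W.st (n + l + 1)).shade < (W.st (n + l)).shade := by
  haveI : Fact p.Prime := ⟨hp⟩
  exact exists_drop_of_shade_lt_of_pow_witness p (fun k => W.st (n + k)) (fun k => W.j (n + k))
    (fun k => W.b (n + k)) (fun k => W.onExc (n + k)) (fun k => W.st_succ (n + k)) (walk_r hroot W n)
    (fun k => walk_ord hroot W (n + k)) hw m hm

/-- **W2 along a forced walk (PROVED from tree `exists_drop_of_shade_lt_after_jump_of_pow_dvd`)**: after a jump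
landing on a `q`-divisible order, the shade cannot rise again without a strict drop in between.
(Sources: Moh1987, Stability Theorem.) [folklore] -/
theorem exists_drop_before_rejump_of_dvd_landing (hp : p.Prime) (hroot : IsRoot (p ^ e) s₀)
    (W : ForcedWalk (p ^ e) s₀) (n : ℕ) (hinc : (W.st n).shade < (W.st (n + 1)).shade) {o₁ : ℕ}
    (ho₁ : ordZero (W.st (n + 1)).F = o₁) (hdvd : p ^ e ∣ o₁) (m : ℕ)
    (hm : (W.st (n + 1)).shade < (W.st (n + 1 + m)).shade) :
    ∃ l < m, (W.st (n + 1 + l + 1)).shade < (W.st (n + 1 + l)).shade := by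
  haveI : Fact p.Prime := ⟨hp⟩
  obtain ⟨o, ho, -⟩ := walk_nat hroot W n
  exact exists_drop_of_shade_lt_after_jump_of_pow_dvd p W.st W.j W.b W.onExc W.st_succ (walk_ord hroot W) n
    (walk_clean hroot W n) ho (walk_r hroot W n) hinc ho₁ hdvd m hm

end Jumps

/-! ## §4 The pieces and the EXACT cut of the blocker -/

/-- **`NoPlateauWalksDeep`** — no infinite forced deep walk (`q = pᵉ`, `e ≥ 2`, positive shade throughout) whose
shade is eventually constant.  [UNDECIDED · WEAKER (`noPlateau_of_deep`) · IDEA-NEEDED · INSTRUMENTABLE T-plateau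
(Hasse–Milnor colength on stall steps)]  (Sources: Hauser2010 §G; Moh1987; BenitoVillamayor2013 §7.) -/
def NoPlateauWalksDeep : Prop :=
  ∀ p : ℕ, p.Prime → ∀ e : ℕ, 2 ≤ e → ∀ (K : Type) [Field K] [CharP K p] [PerfectField K] [DecidableEq K]
    (s₀ : State (Fin 3) K), IsRoot (p ^ e) s₀ → ∀ W : ForcedWalk (p ^ e) s₀, (∀ i, 1 ≤ (W.st i).shade) →
    EventuallyStalls (fun i => (W.st i).shade) → False

/-- **`NoRecurrentJumpWalksDeep`** — no infinite forced deep walk whose shade increases at infinitely many times.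
[UNDECIDED · WEAKER (`noRecurrentJump_of_deep`) · IDEA-NEEDED · ATTACKABLE (jump calculus §3: every jump is
boundary-resonant, Moh-bounded, and separated from the next rise above a witnessed level by a drop) · INSTRUMENTABLE
T-jump-e2]  (Sources: Hauser2010 §F; HauserPerlega2019; Moh1987.) -/
def NoRecurrentJumpWalksDeep : Prop :=
  ∀ p : ℕ, p.Prime → ∀ e : ℕ, 2 ≤ e → ∀ (K : Type) [Field K] [CharP K p] [PerfectField K] [DecidableEq K]
    (s₀ : State (Fin 3) K), IsRoot (p ^ e) s₀ → ∀ W : ForcedWalk (p ^ e) s₀, (∀ i, 1 ≤ (W.st i).shade) →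
    RecurrentJumps (fun i => (W.st i).shade) → False

/-- **`NoRecurrentBoundaryJumpWalksDeep`** — the same with the jumps required to happen ON the boundary (`r ≠ 0`):
EXACT reformulation of the jump half, since boundary-free jumps do not exist (`not_jump_of_boundaryFree`).
[UNDECIDED · EQUIVALENT to `NoRecurrentJumpWalksDeep` (`noRecurrentJump_iff_boundary`) · IDEA-NEEDED]
(Sources: Hauser2010 §F.) -/
def NoRecurrentBoundaryJumpWalksDeep : Prop :=
  ∀ p : ℕ, p.Prime → ∀ e : ℕ, 2 ≤ e → ∀ (K : Type) [Field K] [CharP K p] [PerfectField K] [DecidableEq K]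
    (s₀ : State (Fin 3) K), IsRoot (p ^ e) s₀ → ∀ W : ForcedWalk (p ^ e) s₀, (∀ i, 1 ≤ (W.st i).shade) →
    (∀ N : ℕ, ∃ t, N ≤ t ∧ (W.st t).r ≠ 0 ∧ (W.st t).shade < (W.st (t + 1)).shade) → False

/-- The plateau half is WEAKER than the blocker (PROVED). [folklore] -/
theorem noPlateau_of_deep (h : DefectWalksTerminateDeep) : NoPlateauWalksDeep :=
  fun p hp e he K _ _ _ _ s₀ hs W hpos _ => h p hp e he K s₀ hs W hpos

/-- The jump half is WEAKER than the blocker (PROVED). [folklore] -/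
theorem noRecurrentJump_of_deep (h : DefectWalksTerminateDeep) : NoRecurrentJumpWalksDeep :=
  fun p hp e he K _ _ _ _ s₀ hs W hpos _ => h p hp e he K s₀ hs W hpos

/-- **The blocker from the two halves (PROVED, kernel `recurrentJumps_or_eventuallyStalls`).** [folklore] -/
theorem deep_of_itinerary (h₁ : NoPlateauWalksDeep) (h₂ : NoRecurrentJumpWalksDeep) : DefectWalksTerminateDeep := by
  intro p hp e he K _ _ _ _ s₀ hs W hpos
  rcases recurrentJumps_or_eventuallyStalls (fun i => (W.st i).shade) with hR | hS
  · exact h₂ p hp e he K s₀ hs W hpos hR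
  · exact h₁ p hp e he K s₀ hs W hpos hS

/-- **EXACT CUT (PROVED): `DefectWalksTerminateDeep ⟺ NoPlateauWalksDeep ∧ NoRecurrentJumpWalksDeep`.** [folklore] -/
theorem defectDeep_iff : DefectWalksTerminateDeep ↔ NoPlateauWalksDeep ∧ NoRecurrentJumpWalksDeep :=
  ⟨fun h => ⟨noPlateau_of_deep h, noRecurrentJump_of_deep h⟩, fun h => deep_of_itinerary h.1 h.2⟩

/-- **The jump half, EXACTLY reformulated on the boundary (PROVED, `not_jump_of_boundaryFree`).** [folklore] -/
theorem noRecurrentJump_iff_boundary : NoRecurrentJumpWalksDeep ↔ NoRecurrentBoundaryJumpWalksDeep := by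
  constructor
  · intro h p hp e he K _ _ _ _ s₀ hs W hpos hB
    exact h p hp e he K s₀ hs W hpos fun N => by
      obtain ⟨t, ht, -, hj⟩ := hB N
      exact ⟨t, ht, hj⟩
  · intro h p hp e he K _ _ _ _ s₀ hs W hpos hR
    refine h p hp e he K s₀ hs W hpos fun N => ?_
    obtain ⟨t, ht, hj⟩ := hR N
    refine ⟨t, ht, fun hr0 => ?_, hj⟩
    exact not_jump_of_boundaryFree hp hs W t hr0 hj

/-- Structure of the jump half (PROVED): along a recurrent-jump walk the RESONANT BOUNDARY states recur.
[folklore]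
(Sources: Hauser2010 §F.) -/
theorem resonant_io_of_recurrentJumps {p e : ℕ} (hp : p.Prime) {K : Type} [Field K] [CharP K p] [DecidableEq K]
    {s₀ : State (Fin 3) K} (hs : IsRoot (p ^ e) s₀) (W : ForcedWalk (p ^ e) s₀)
    (hR : RecurrentJumps (fun i => (W.st i).shade)) :
    ∀ N : ℕ, ∃ t, N ≤ t ∧ (W.st t).r ≠ 0 ∧ Resonant (p ^ e) (W.st t) := by
  intro N
  obtain ⟨t, ht, hj⟩ := hR N
  exact ⟨t, ht, fun hr0 => not_jump_of_boundaryFree hp hs W t hr0 hj, resonant_of_jump hp hs W t hj⟩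

/-! ## §5 The E-format column and ROOT BY NAME -/

/-- **The deep E-format column hangs on the two halves** (+ the dictionary port and the shade-0 walks, the latter
PROVED in lens-3 g9 as `strongWalksTerminate`, landing as `Theorems.TightDefectStrongWalks`). [folklore] -/
theorem polyPureTowersTerminateDeep_of_itinerary (hT : TowerDictionary) (hS : StrongWalksTerminate)
    (h₁ : NoPlateauWalksDeep) (h₂ : NoRecurrentJumpWalksDeep) : PolyPureTowersTerminateDeep := by
  have hΔ := deep_of_itinerary h₁ h₂
  intro p hp e he k _ _ _ F T g hg hD hB hR
  refine hT p hp e (one_le_two.trans he) k F T g hg hD hB hR ?_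
  intro K _ _ _ _ s₀ hs W
  by_cases h0 : ∃ i, (W.st i).shade = 0
  · exact hS p hp e (one_le_two.trans he) K s₀ hs W h0
  · exact hΔ p hp e he K s₀ hs W (fun i => Order.one_le_iff_ne_zero.mpr (fun h => h0 ⟨i, h⟩))

/-- … and the whole slice with the CP column discharged through the valuative port (tree `shallow_of_port`).
[folklore] -/
theorem polyPureTowersTerminate_of_itinerary
    (hCP : Literature.AlgebraicGeometry.Resolution.CossartPiltant2019LocalPermissible.{0}) (hV : ShallowColumnPort)
    (hT : TowerDictionary) (hS : StrongWalksTerminate) (h₁ : NoPlateauWalksDeep) (h₂ : NoRecurrentJumpWalksDeep) :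
    PolyPureTowersTerminate :=
  polyPureTowersTerminate_of_columns (shallow_of_port hCP hV) (polyPureTowersTerminateDeep_of_itinerary hT hS h₁ h₂)

end Summit.ResolutionOfSingularities.ResolutionOfSingularities.Theorems.ItineraryCutClasses
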